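import Mathlib
import Summits.NavierStokesRegularity.NavierStokesRegularity.Theorems.ThreadingFluxHorizonTowerFiniteTowerThirdShell
import HarnessLib

/-!
# Crux `PoloidalLiouville` (stmt-NavierStokesRegularity-1222), crux idea «horizon-threading-tower» (ns-idea-15):
# FINITE TOWERS AT ORDER ONE — THM C″: ANY THIRD SHELL ISOLATED AGAINST THE TOP IN ITS PARITY CLASS

Support file (`--supports stmt-NavierStokesRegularity-1222`, helper; cell `ns-wall-extremal`, width hand ns-wall-eng-3 g4; 0 kit).

The general form behind THM C (`finiteTower_zonal_of_oppositeParity`, p704844): let `D′ < D` be the two largest degrees of a finite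
tower passing order one and `c ∈ K` a third degree such that the pair `(c, D)` is ISOLATED IN ITS PARITY CLASS — no other pair
`j < k` of degrees of `K` with `j + k ≥ c + D` and `j + k ≡ c + D (mod 2)` (a finite combinatorial condition on `K`).  Then
`c·f_c·g′ = D·g·f_c′` (`finiteTower_chartT_detP_eq_zero_of_class`) besides the top relation `D′·f_{D′}·g′ = D·g·f_{D′}′`, so the root
multiplicities of the top chart are divisible by `D / gcd(D, D′, c)`:

* ★★ `finiteTower_zonal_of_isolatedThird` (THM C″): `H_D, H_{D′}, H_c ≢ 0`, `(c, D)` isolated in its class, `Nat.Coprime D (Nat.gcd D′ c)`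
  ⇒ the tower is coaxially zonal.  THM C is the case `c` = the largest degree of the parity opposite to `D ≡ D′` (isolation automatic);
  the case `D′ ≢ D (mod 2)`, `c` = the largest degree `≡ D` below `D` is isolated iff no two degrees `c < j < k < D` of `K` have
  `j + k ≥ c + D` (e.g. `{3,4,10,15}`, `{2,5,6,15}` are decided; `{1,4,6,9}` is not isolated).

HONEST LABEL: special cases of the crux-idea conjecture `HorizonTowerZonality` (order one); all-one-parity towers with non-coprime
top pair, general towers, `PoloidalLiouville` (1222) OPEN; W1 movement 0; NS regularity NOT proved.  [folklore]
-/

-- the summit and its single sub-problem share the name (CONVENTIONS §1)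
set_option linter.dupNamespace false

noncomputable section

open MvPolynomial Complex
open scoped Polynomial RealInnerProductSpace
open Literature.Analysis.FluidPDE (cross)

namespace Summit.NavierStokesRegularity.NavierStokesRegularity.Theorems.PoloidalLiouville.HorizonTower

section IsolatedThird

variable (K : Finset ℕ) (H : ℕ → E3 → ℝ)

/-- **THM C″, polynomial level**: an isolated third pair `(c, D)` with `gcd(D, D′, c) = 1` forces a zonal top shell. [folklore] -/
theorem finiteTower_exists_axis_of_isolatedThird (hK : ∀ l ∈ K, 1 ≤ l) (hH : ∀ l ∈ K, ContDiff ℝ (⊤ : ℕ∞) (H l))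
    (hhom : ∀ l ∈ K, ∀ (c : ℝ) (y : E3), H l (c • y) = c ^ l * H l y)
    (hharm : ∀ l ∈ K, ∀ y, Laplacian.laplacian (H l) y = 0)
    (hL1 : ∀ x : E3, x ≠ 0 → horizonL1 (fun z => ∑ l ∈ K, horizonProfile l (H l) 0 z) 0 x = 0)
    (P : ℕ → MvPolynomial (Fin 3) ℝ)
    (hP : ∀ l ∈ K, (P l).IsHomogeneous l ∧ Zonal.lapP (P l) = 0 ∧ ∀ y, H l y = Zonal.evalE (P l) y)
    {D D' c : ℕ} (hD : D ∈ K) (hD' : D' ∈ K) (hlt : D' < D) (hmax : ∀ l ∈ K, l ≤ D) (hsec : ∀ l ∈ K, l ≠ D → l ≤ D')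
    (hcK : c ∈ K) (hcD : c ≠ D)
    (hiso : ∀ j ∈ K, ∀ k ∈ K, j < k → c + D ≤ j + k → (j + k) % 2 = (c + D) % 2 → ¬(j = c ∧ k = D) → False)
    (hcop : Nat.Coprime D (Nat.gcd D' c)) (hPD : P D ≠ 0) (hPD' : P D' ≠ 0) (hPc : P c ≠ 0) :
    ∃ n : Fin 3 → ℝ, n ≠ 0 ∧ Zonal.detP (C (n 0) * X 0 + C (n 1) * X 1 + C (n 2) * X 2) (P D) = 0 := by
  -- `(c, D)` is isolated inside its parity class (ordered-pair form of the hypothesis)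
  have hiso' := finiteTower_chartT_detP_eq_zero_of_class K H hK hH hhom hharm hL1 P (fun l hl => (hP l hl).2.2) hcK hD hcD (by
    intro j hj k hk hjk hsum hcls h1 h2
    exfalso
    rcases lt_or_gt_of_ne hjk with hjk' | hjk'
    · exact hiso j hj k hk hjk' hsum hcls h1
    · refine hiso k hk j hj hjk' (by omega) (by rw [add_comm]; exact hcls) ?_
      rintro ⟨rfl, rfl⟩; exact h2 ⟨rfl, rfl⟩)
  set fc : ℂ[X] := Zonal.chartT (map (algebraMap ℝ ℂ) (P c)) with hfc
  set fD' : ℂ[X] := Zonal.chartT (map (algebraMap ℝ ℂ) (P D')) with hfD'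
  set g : ℂ[X] := Zonal.chartT (map (algebraMap ℝ ℂ) (P D)) with hg
  have hfc0 : fc ≠ 0 := fun h => hPc (Zonal.eq_zero_of_chartT_map_eq_zero (hP c hcK).1 (hP c hcK).2.1 h)
  have hfD'0 : fD' ≠ 0 := fun h => hPD' (Zonal.eq_zero_of_chartT_map_eq_zero (hP D' hD').1 (hP D' hD').2.1 h)
  have hg0 : g ≠ 0 := fun h => hPD (Zonal.eq_zero_of_chartT_map_eq_zero (hP D hD).1 (hP D hD).2.1 h)
  have hWc : (c : ℂ[X]) * fc * Polynomial.derivative g = (D : ℂ[X]) * g * Polynomial.derivative fc := by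
    have h := Zonal.chartT_detP (((hP c hcK).1).map (algebraMap ℝ ℂ)) (((hP D hD).1).map (algebraMap ℝ ℂ))
    rw [← Zonal.map_detP, hiso', mul_zero] at h
    exact sub_eq_zero.mp h.symm
  have hWD' := finiteTower_top_wronskian K H hK hH hhom hharm hL1 P (fun l hl => ⟨(hP l hl).1, (hP l hl).2.2⟩) hD hD' hlt
    hmax hsec
  obtain ⟨c₁, hc₁⟩ := Zonal.exists_C_mul_of_wronskian_eq_zero (pow_ne_zero _ hg0)
    (Zonal.wronskian_pow_pow_eq_zero (hK c hcK) (hK D hD) hWc)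
  obtain ⟨c₂, hc₂⟩ := Zonal.exists_C_mul_of_wronskian_eq_zero (pow_ne_zero _ hg0)
    (Zonal.wronskian_pow_pow_eq_zero (hK D' hD') (hK D hD) hWD')
  obtain ⟨q, hqm, hgq, hdeg⟩ := Zonal.exists_monic_eq_C_mul_pow_of_two_rel (hK D hD) hfD'0 hfc0 hc₂ hc₁ hcop
  have hq2 : q.natDegree ≤ 2 := by
    have h1 : g.natDegree ≤ 2 * D := Zonal.natDegree_chartT_le (((hP D hD).1).map (algebraMap ℝ ℂ))
    have h2 : D * q.natDegree ≤ D * 2 := by rw [hdeg, mul_comm]; exact h1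
    exact Nat.le_of_mul_le_mul_left h2 (hK D hD)
  exact Zonal.exists_real_axis_of_chartT_eq_pow (hP D hD).1 (hK D hD) (hP D hD).2.1 hqm.ne_zero hq2 hgq

/-- ★★ **THM C″ — ISOLATED THIRD SHELL.**  A finite scale-free tower of horizon profiles passing order one, with top degrees
`D′ < D`, a third degree `c ≠ D` whose pair `(c, D)` is isolated in its parity class (no pair `j < k` of degrees of `K` other than
`(c, D)` has `j + k ≥ c + D` and `j + k ≡ c + D (mod 2)`), `H_D, H_{D′}, H_c ≢ 0` and `gcd(D, D′, c) = 1`, is COAXIALLY ZONAL.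
[folklore] -/
theorem finiteTower_zonal_of_isolatedThird (hK : ∀ l ∈ K, 1 ≤ l) (hH : ∀ l ∈ K, ContDiff ℝ (⊤ : ℕ∞) (H l))
    (hhom : ∀ l ∈ K, ∀ (c : ℝ) (y : E3), H l (c • y) = c ^ l * H l y)
    (hharm : ∀ l ∈ K, ∀ y, Laplacian.laplacian (H l) y = 0)
    (hL1 : ∀ x : E3, x ≠ 0 → horizonL1 (fun z => ∑ l ∈ K, horizonProfile l (H l) 0 z) 0 x = 0)
    {D D' c : ℕ} (hD : D ∈ K) (hD' : D' ∈ K) (hlt : D' < D) (hmax : ∀ l ∈ K, l ≤ D) (hsec : ∀ l ∈ K, l ≠ D → l ≤ D')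
    (hcK : c ∈ K) (hcD : c ≠ D)
    (hiso : ∀ j ∈ K, ∀ k ∈ K, j < k → c + D ≤ j + k → (j + k) % 2 = (c + D) % 2 → ¬(j = c ∧ k = D) → False)
    (hcop : Nat.Coprime D (Nat.gcd D' c)) (hD0 : ∃ y, H D y ≠ 0) (hD'0 : ∃ y, H D' y ≠ 0) (hc0 : ∃ y, H c y ≠ 0) :
    ∃ b : E3, b ≠ 0 ∧ ∀ l ∈ K, ∀ y : E3, ⟪cross b y, gradient (H l) y⟫ = 0 := by
  obtain ⟨P, hP⟩ := finiteTower_exists_polys K H hH hhom hharm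
  have hne : ∀ {l}, l ∈ K → (∃ y, H l y ≠ 0) → P l ≠ 0 := by
    intro l hl ⟨y, hy⟩ h
    apply hy
    rw [(hP l hl).2.2 y, h]
    simp [Zonal.evalE]
  obtain ⟨n, hn, htop⟩ := finiteTower_exists_axis_of_isolatedThird K H hK hH hhom hharm hL1 P hP hD hD' hlt hmax hsec hcK hcD
    hiso hcop (hne hD hD0) (hne hD' hD'0) (hne hcK hc0)
  have hna : (WithLp.toLp 2 n : E3) ≠ 0 := by
    intro h
    apply hn
    funext i
    have := congrArg (fun v : E3 => v i) h
    simpa using this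
  refine ⟨WithLp.toLp 2 n, hna, fun l hl y => ?_⟩
  have h := finiteTower_detP_lin_eq_zero_of_top K H hK hH hhom hharm hL1 P hP hD hmax (hne hD hD0) hn htop l hl
  rw [Zonal.detP_lin_eq_zero_iff] at h
  have := h y
  rwa [← show H l = Zonal.evalE (P l) from funext (hP l hl).2.2] at this

/-- THM C″ with the zonal functional forms. [folklore] -/
theorem finiteTower_zonalForm_of_isolatedThird (hK : ∀ l ∈ K, 1 ≤ l) (hH : ∀ l ∈ K, ContDiff ℝ (⊤ : ℕ∞) (H l))
    (hhom : ∀ l ∈ K, ∀ (c : ℝ) (y : E3), H l (c • y) = c ^ l * H l y)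
    (hharm : ∀ l ∈ K, ∀ y, Laplacian.laplacian (H l) y = 0)
    (hL1 : ∀ x : E3, x ≠ 0 → horizonL1 (fun z => ∑ l ∈ K, horizonProfile l (H l) 0 z) 0 x = 0)
    {D D' c : ℕ} (hD : D ∈ K) (hD' : D' ∈ K) (hlt : D' < D) (hmax : ∀ l ∈ K, l ≤ D) (hsec : ∀ l ∈ K, l ≠ D → l ≤ D')
    (hcK : c ∈ K) (hcD : c ≠ D)
    (hiso : ∀ j ∈ K, ∀ k ∈ K, j < k → c + D ≤ j + k → (j + k) % 2 = (c + D) % 2 → ¬(j = c ∧ k = D) → False)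
    (hcop : Nat.Coprime D (Nat.gcd D' c)) (hD0 : ∃ y, H D y ≠ 0) (hD'0 : ∃ y, H D' y ≠ 0) (hc0 : ∃ y, H c y ≠ 0) :
    ∃ b : E3, b ≠ 0 ∧ ∀ l ∈ K, ∃ g : ℝ → ℝ, ∀ y : E3, y ≠ 0 → H l y = ‖y‖ ^ l * g (⟪b, y⟫ / ‖y‖) := by
  obtain ⟨b, hb, hrot⟩ := finiteTower_zonal_of_isolatedThird K H hK hH hhom hharm hL1 hD hD' hlt hmax hsec hcK hcD hiso hcop hD0
    hD'0 hc0
  exact ⟨b, hb, fun l hl => exists_zonalForm_of_inner_cross_gradient_eq_zero (l := l) hb ((hH l hl).differentiable (by simp))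
    (fun c y _ => hhom l hl c y) (hrot l hl)⟩

end IsolatedThird

end Summit.NavierStokesRegularity.NavierStokesRegularity.Theorems.PoloidalLiouville.HorizonTower

end
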